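import Mathlib
import Literature.AlgebraicGeometry.Resolution.CobordantGame
import Summits.ResolutionOfSingularities.ResolutionOfSingularities.Theorems.WeightedInvariantLocalWeightedDropTwistedTrivialOrderDrop

/-!
# `WeightedInvariant.LocalWeightedDrop`: POSITIVE twisted-triviality witnesses (§9 R4-3/R4-4, idle variables, units)

Route `ResolutionOfSingularities/WeightedInvariant`, crux `LocalWeightedDrop`
(stmt-ResolutionOfSingularities-8899).  [OURS · L1 W4.3] — positive membership in the I-saturation proxy of
ideator res-L1-w43-idea-1's card A (`Sketch-L1-idea-1.lean` v4 §9), for the ORIGIN-FIXING predicate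
`GradedGame.TwistedTrivialAlongFix` (= the sketch's v4 `TwistedTrivialAlong`).  Nothing here is a statement of
the manuscript under review on ladder RESOLUTION; AI-produced, weaker than expert review.

* `subst_congr_of_idle`, `twistedTrivialAlongFix_axis_of_idle` — a germ not involving `xᵢ` is (honestly,
  `e = 0`, `Φ = id`) twisted-trivial along the `xᵢ`-axis; `idle_of_subst_kill_eq` is the practical test.
  (Rule-free content of the first third of the sketch's R4-6 «cylinder functoriality».)
* `twistedTrivialAlongFix_unit_mul_iff` — twisted triviality absorbs units (`p ≠ 0`).  (Rule-free content of
  the `satSet` third of the sketch's R4-7 «unit invariance».)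
* R4-3 `s1w_twistedTrivialFix_u` — S1's WILD POINT `h = X² + uZ⁴ + u³S⁴` (char 2; variables `0 = X, 1 = Z,
  2 = S, 3 = u`) is twisted-trivial of exponent `2¹` along the `u`-axis, with the sketch's explicit origin-fixing
  unipotent `Φ : X ↦ X + σZ² + σ³S² + σuS², Z ↦ Z + σS, S ↦ S, u ↦ u` and `u := 1`.
* R4-4 `f11_twistedTrivialFix_z` — the F11 umbrella node `G = Z² + z·w′²` (char 2; variables `0 = Z, 1 = w′,
  2 = z, 3 = y, 4 = s₁`) is twisted-trivial of exponent `2¹` along `z` (`Φ : Z ↦ Z + σw′`), and honestly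
  trivial along the idle `y, s₁` (`f11_twistedTrivialFix_idle`).
The characteristic-2 identities are closed by `linear_combination c * (2 = 0)` with an explicit cofactor `c`.
-/

set_option linter.dupNamespace false -- mandated namespace of this single-conjunct summit
set_option autoImplicit false

namespace Summit.ResolutionOfSingularities.ResolutionOfSingularities.Theorems

namespace GradedGame

open MvPowerSeries
open Literature.AlgebraicGeometry.Resolution

variable {k : Type} [Field k]

/-! ## Idle variables -/

/-- Substitution families that agree off an IDLE variable of `f` give the same result. [OURS · L1 W4.3] -/
theorem subst_congr_of_idle {n m : ℕ} {a b : Fin n → MvPowerSeries (Fin m) k} (ha : HasSubst a) (hb : HasSubst b)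
    (f : MvPowerSeries (Fin n) k) (i : Fin n) (hf : ∀ d, coeff d f ≠ 0 → d i = 0)
    (hab : ∀ j, j ≠ i → a j = b j) : subst a f = subst b f := by
  ext μ
  rw [coeff_subst ha, coeff_subst hb]
  apply finsum_congr
  intro d
  by_cases hd : coeff d f = 0
  · simp [hd]
  · have hdi := hf d hd
    congr 2
    apply Finsupp.prod_congr
    intro j hj
    rw [hab j (fun hji => (Finsupp.mem_support_iff.mp hj) (hji ▸ hdi))]

/-- Killing a non-kept variable kills every coefficient off the kept variables. [OURS · L1 W4.3] -/
theorem coeff_subst_keep_eq_zero {N : ℕ} (P : Fin N → Prop) [DecidablePred P] (ψ : MvPowerSeries (Fin N) k)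
    (μ : Fin N →₀ ℕ) (v : Fin N) (hv : μ v ≠ 0) (hPv : ¬ P v) :
    coeff μ (subst (fun u : Fin N => if P u then (X u : MvPowerSeries (Fin N) k) else 0) ψ) = 0 := by
  classical
  rw [coeff_subst (hasSubst_keep P)]
  apply finsum_eq_zero_of_forall_eq_zero
  intro d
  rw [prod_pow_keep_eq]
  split_ifs with h
  · rw [coeff_monomial]
    split_ifs with hμd
    · subst hμd
      exact absurd (h v (Finsupp.mem_support_iff.mpr hv)) hPv
    · rw [smul_zero]
  · rw [map_zero, smul_zero]

/-- IDLE-VARIABLE TEST: if killing `xᵢ` does not change `f`, then `f` does not involve `xᵢ`. [OURS · L1 W4.3] -/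
theorem idle_of_subst_kill_eq {n : ℕ} (i : Fin n) (f : MvPowerSeries (Fin n) k)
    (h : subst (fun u : Fin n => if u ≠ i then (X u : MvPowerSeries (Fin n) k) else 0) f = f) :
    ∀ d, coeff d f ≠ 0 → d i = 0 := by
  classical
  intro d hd
  by_contra hdi
  apply hd
  rw [← h]
  exact coeff_subst_keep_eq_zero (fun u : Fin n => u ≠ i) f d i hdi (not_not.mpr rfl)

/-- A germ NOT INVOLVING `xᵢ` is twisted-trivial along the `xᵢ`-axis in the origin-fixing sense, honestly:
`e = 0`, `Φ = id`, `u = 1` (the translate `f(x + σ eᵢ)` IS `f`).  [OURS · L1 W4.3] -/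
theorem twistedTrivialAlongFix_axis_of_idle (p : ℕ) {n : ℕ} (f : MvPowerSeries (Fin n) k) (i : Fin n)
    (hf : ∀ d, coeff d f ≠ 0 → d i = 0) : TwistedTrivialAlongFix p f (axisCurve i) := by
  classical
  have ha : HasSubst (fun _ : Fin 1 => (X (0 : Fin (n + 1)) : MvPowerSeries (Fin (n + 1)) k) ^ (p ^ 0)) :=
    hasSubst_of_constantCoeff_zero fun _ => by simp [constantCoeff_X]
  set T : Fin n → MvPowerSeries (Fin (n + 1)) k := fun j => X j.succ +
    subst (fun _ : Fin 1 => (X (0 : Fin (n + 1)) : MvPowerSeries (Fin (n + 1)) k) ^ (p ^ 0)) (axisCurve (k := k) i j)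
    with hT
  have hTj : ∀ j, T j = X j.succ + if j = i then X 0 ^ (p ^ 0) else 0 := by
    intro j
    simp only [hT, axisCurve]
    by_cases hj : j = i
    · rw [if_pos hj, if_pos hj, subst_X ha]
    · rw [if_neg hj, if_neg hj, ← coe_substAlgHom ha, map_zero]
  have hTs : HasSubst T := hasSubst_of_constantCoeff_zero fun j => by
    rw [hTj]; by_cases hj : j = i <;> simp [hj, constantCoeff_X]
  set Φ : Fin n → MvPowerSeries (Fin (n + 1)) k := fun j => X j.succ with hΦ
  have hΦs : HasSubst Φ := hasSubst_of_constantCoeff_zero fun j => by simp [hΦ, constantCoeff_X]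
  refine ⟨fun j => ?_, 0, Φ, 1, isUnit_one, fun j => by simp [hΦ, constantCoeff_X], fun j => ?_, ?_, ?_⟩
  · unfold axisCurve; split_ifs <;> simp [constantCoeff_X]
  · have hK := hasSubst_keep (k := k) (fun v : Fin (n + 1) => v = 0)
    have : (fun v : Fin (n + 1) => if v = 0 then (X (0 : Fin (n + 1)) : MvPowerSeries (Fin (n + 1)) k) else 0) =
        fun v : Fin (n + 1) => if v = 0 then (X v : MvPowerSeries (Fin (n + 1)) k) else 0 := by
      funext v; by_cases hv : v = 0 <;> simp [hv]
    rw [this, hΦ]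
    simp only
    rw [subst_X hK]
    simp [Fin.succ_ne_zero]
  · have hM : (Matrix.of fun i j : Fin n => coeff (Finsupp.single j.succ 1) (Φ i)) = (1 : Matrix (Fin n) (Fin n) k) := by
      ext a b
      rw [Matrix.of_apply, hΦ, coeff_X, Matrix.one_apply]
      by_cases h : a = b
      · subst h; simp
      · rw [if_neg, if_neg h]
        intro h'
        exact h ((Fin.succ_injective _ ((Finsupp.single_left_inj one_ne_zero).mp h')).symm)
    rw [hM, Matrix.det_one]
    exact isUnit_one
  · change subst T f = 1 * subst Φ f
    rw [one_mul]
    exact subst_congr_of_idle hTs hΦs f i hf fun j hj => by rw [hTj, if_neg hj, add_zero]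

/-! ## Units -/

/-- Substitutable families have zero constant terms, so substitution preserves units. [OURS · L1 W4.3] -/
theorem isUnit_subst {n m : ℕ} {a : Fin n → MvPowerSeries (Fin m) k} (ha : HasSubst a) {u : MvPowerSeries (Fin n) k}
    (hu : IsUnit u) : IsUnit (subst a u) := by
  rw [← coe_substAlgHom ha]
  exact hu.map _

/-- TWISTED TRIVIALITY ABSORBS UNITS: `u₀ · F` is twisted-trivial along `γ` iff `F` is (`p ≠ 0`; same `e`, same
`Φ`). [OURS · L1 W4.3; rule-free `satSet` third of Sketch-L1-idea-1 v4 §9 R4-7] -/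
theorem twistedTrivialAlongFix_unit_mul_iff (p : ℕ) (hp : p ≠ 0) {n : ℕ} (F u₀ : MvPowerSeries (Fin n) k)
    (hu₀ : IsUnit u₀) (γ : Fin n → MvPowerSeries (Fin 1) k) :
    TwistedTrivialAlongFix p (u₀ * F) γ ↔ TwistedTrivialAlongFix p F γ := by
  constructor
  · rintro ⟨hγ, e, Φ, u, hu, hΦ0, hfix, hdet, heq⟩
    have hTs := hasSubst_translateFamilyPow (p ^ e) (pow_ne_zero e hp) γ hγ
    have hΦs : HasSubst Φ := hasSubst_of_constantCoeff_zero hΦ0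
    obtain ⟨w, hw⟩ := (isUnit_subst hTs hu₀).exists_left_inv
    refine ⟨hγ, e, Φ, w * u * subst Φ u₀, (((IsUnit.of_mul_eq_one _ hw).mul hu).mul (isUnit_subst hΦs hu₀)),
      hΦ0, hfix, hdet, ?_⟩
    rw [subst_mul hTs, subst_mul hΦs] at heq
    calc subst _ F = w * (subst _ u₀ * subst _ F) := by rw [← mul_assoc, hw, one_mul]
      _ = w * (u * (subst Φ u₀ * subst Φ F)) := by rw [heq]
      _ = w * u * subst Φ u₀ * subst Φ F := by ring
  · rintro ⟨hγ, e, Φ, u, hu, hΦ0, hfix, hdet, heq⟩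
    have hTs := hasSubst_translateFamilyPow (p ^ e) (pow_ne_zero e hp) γ hγ
    have hΦs : HasSubst Φ := hasSubst_of_constantCoeff_zero hΦ0
    obtain ⟨w, hw⟩ := (isUnit_subst hΦs hu₀).exists_left_inv
    refine ⟨hγ, e, Φ, subst _ u₀ * u * w, ((isUnit_subst hTs hu₀).mul hu).mul (IsUnit.of_mul_eq_one _ hw),
      hΦ0, hfix, hdet, ?_⟩
    rw [subst_mul hTs, subst_mul hΦs, heq]
    calc subst _ u₀ * (u * subst Φ F) = subst _ u₀ * u * (w * subst Φ u₀) * subst Φ F := by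
          rw [hw]; ring
      _ = subst _ u₀ * u * w * (subst Φ u₀ * subst Φ F) := by ring
where
  /-- The translation family along `γ` with parameter `σ^q` is substitutable (`q ≠ 0`). -/
  hasSubst_translateFamilyPow {n : ℕ} (q : ℕ) (hq : q ≠ 0) (γ : Fin n → MvPowerSeries (Fin 1) k)
      (hγ : ∀ i, constantCoeff (γ i) = 0) :
      HasSubst (fun i : Fin n => X i.succ +
        subst (fun _ : Fin 1 => (X (0 : Fin (n + 1)) : MvPowerSeries (Fin (n + 1)) k) ^ q) (γ i)) := by
    have ha : HasSubst (fun _ : Fin 1 => (X (0 : Fin (n + 1)) : MvPowerSeries (Fin (n + 1)) k) ^ q) :=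
      hasSubst_of_constantCoeff_zero fun _ => by simp [constantCoeff_X, zero_pow hq]
    exact hasSubst_of_constantCoeff_zero fun i => by
      rw [map_add, constantCoeff_X, zero_add]
      exact constantCoeff_subst_eq_zero ha (fun _ => by simp [constantCoeff_X, zero_pow hq]) (hγ i)

/-! ## Explicit witnesses (characteristic 2) -/

/-- The linear coefficients of a product of two series with zero constant terms vanish. [OURS · L1 W4.3] -/
theorem coeff_single_one_mul_eq_zero {m : ℕ} (φ ψ : MvPowerSeries (Fin m) k) (hφ : constantCoeff φ = 0)
    (hψ : constantCoeff ψ = 0) (v : Fin m) : coeff (Finsupp.single v 1) (φ * ψ) = 0 := by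
  apply coeff_of_lt_order
  calc ((Finsupp.degree (Finsupp.single v 1) : ℕ) : ℕ∞) = 1 := by simp
    _ < 1 + 1 := by decide
    _ ≤ φ.order + ψ.order := add_le_add (one_le_order_iff_constCoeff_eq_zero.mpr hφ)
        (one_le_order_iff_constCoeff_eq_zero.mpr hψ)
    _ ≤ (φ * ψ).order := le_order_mul

/-- Common packaging of an explicit witness `Φ j = x_j + extra j`, `u = 1`: the four predicate clauses reduce to
(i) the extras have no constant and no LINEAR `x`-coefficients, (ii) the extras die under `x ↦ 0`, and (iii) the
defining identity. [OURS · L1 W4.3] -/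
theorem twistedTrivialAlongFix_of_unipotent (p e : ℕ) (hpe : p ^ e ≠ 0) {n : ℕ} (f : MvPowerSeries (Fin n) k)
    (i : Fin n) (extra : Fin n → MvPowerSeries (Fin (n + 1)) k) (h0 : ∀ j, constantCoeff (extra j) = 0)
    (hlin : ∀ j l : Fin n, coeff (Finsupp.single l.succ 1) (extra j) = 0)
    (hfix : ∀ j, subst (fun v : Fin (n + 1) => if v = 0 then (X (0 : Fin (n + 1)) : MvPowerSeries (Fin (n + 1)) k)
      else 0) (extra j) = 0)
    (heq : subst (fun j : Fin n => X j.succ + if j = i then (X (0 : Fin (n + 1)) : MvPowerSeries (Fin (n + 1)) k) ^ (p ^ e)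
      else 0) f = subst (fun j : Fin n => X j.succ + extra j) f) :
    TwistedTrivialAlongFix p f (axisCurve i) := by
  classical
  have ha : HasSubst (fun _ : Fin 1 => (X (0 : Fin (n + 1)) : MvPowerSeries (Fin (n + 1)) k) ^ (p ^ e)) :=
    hasSubst_of_constantCoeff_zero fun _ => by simp [constantCoeff_X, zero_pow hpe]
  have hK := hasSubst_keep (k := k) (fun v : Fin (n + 1) => v = 0)
  have hKeq : (fun v : Fin (n + 1) => if v = 0 then (X (0 : Fin (n + 1)) : MvPowerSeries (Fin (n + 1)) k) else 0) =
      fun v : Fin (n + 1) => if v = 0 then (X v : MvPowerSeries (Fin (n + 1)) k) else 0 := by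
    funext v; by_cases hv : v = 0 <;> simp [hv]
  refine ⟨fun j => ?_, e, fun j => X j.succ + extra j, 1, isUnit_one, fun j => ?_, fun j => ?_, ?_, ?_⟩
  · unfold axisCurve; split_ifs <;> simp [constantCoeff_X]
  · rw [map_add, constantCoeff_X, h0 j, add_zero]
  · have h1 := hfix j
    rw [hKeq] at h1 ⊢
    rw [subst_add hK, subst_X hK, h1]
    simp [Fin.succ_ne_zero]
  · have hM : (Matrix.of fun a b : Fin n => coeff (Finsupp.single b.succ 1) (X a.succ + extra a)) =
        (1 : Matrix (Fin n) (Fin n) k) := by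
      ext a b
      rw [Matrix.of_apply, map_add, hlin a b, add_zero, coeff_X, Matrix.one_apply]
      by_cases h : a = b
      · subst h; simp
      · rw [if_neg, if_neg h]
        intro h'
        exact h ((Fin.succ_injective _ ((Finsupp.single_left_inj one_ne_zero).mp h')).symm)
    rw [hM, Matrix.det_one]
    exact isUnit_one
  · rw [one_mul, ← heq]
    congr 1
    funext j
    unfold axisCurve
    by_cases hj : j = i
    · rw [if_pos hj, if_pos hj, subst_X ha]
    · rw [if_neg hj, if_neg hj, ← coe_substAlgHom ha, map_zero]

/-- R4-4 — THE F11 UMBRELLA NODE `G = Z² + z·w′²` (char 2; `0 = Z, 1 = w′, 2 = z, 3 = y, 4 = s₁`) is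
twisted-trivial of exponent `2¹` along `z`: at `z = z + σ²`, `G = (Z + σw′)² + z w′²`, so `Φ : Z ↦ Z + σw′`
(origin-fixing, unipotent) and `u = 1`. [OURS · L1 W4.3, Sketch-L1-idea-1 v4 §9 R4-4 for the repaired predicate] -/
theorem f11_twistedTrivialFix_z [CharP k 2] :
    TwistedTrivialAlongFix 2 (X 0 ^ 2 + X 2 * X 1 ^ 2 : MvPowerSeries (Fin 5) k) (axisCurve 2) := by
  classical
  haveI : CharP (MvPowerSeries (Fin (5 + 1)) k) 2 := charP_of_injective_ringHom C_injective 2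
  have h2 : (2 : MvPowerSeries (Fin (5 + 1)) k) = 0 := CharP.ofNat_eq_zero _ 2
  -- the extra terms: `Z ↦ Z + σ w′`
  set extra : Fin 5 → MvPowerSeries (Fin (5 + 1)) k := fun j =>
    if j = 0 then X 0 * X (Fin.succ (1 : Fin 5)) else 0 with hextra
  have hK := hasSubst_keep (k := k) (fun v : Fin (5 + 1) => v = 0)
  refine twistedTrivialAlongFix_of_unipotent 2 1 (by norm_num) _ 2 extra (fun j => ?_) (fun j l => ?_) (fun j => ?_) ?_
  · simp only [hextra]; split_ifs <;> simp [constantCoeff_X]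
  · simp only [hextra]
    split_ifs
    · exact coeff_single_one_mul_eq_zero _ _ (by simp [constantCoeff_X]) (by simp [constantCoeff_X]) _
    · simp
  · have hKeq : (fun v : Fin (5 + 1) => if v = 0 then (X (0 : Fin (5 + 1)) : MvPowerSeries (Fin (5 + 1)) k) else 0) =
        fun v : Fin (5 + 1) => if v = 0 then (X v : MvPowerSeries (Fin (5 + 1)) k) else 0 := by
      funext v; by_cases hv : v = 0 <;> simp [hv]
    rw [hKeq]
    simp only [hextra]
    split_ifs
    · rw [subst_mul hK, subst_X hK, subst_X hK]
      simp
    · rw [← coe_substAlgHom hK, map_zero]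
  · have hT : HasSubst (fun j : Fin 5 => X j.succ +
        if j = 2 then (X (0 : Fin (5 + 1)) : MvPowerSeries (Fin (5 + 1)) k) ^ (2 ^ 1) else 0) :=
      hasSubst_of_constantCoeff_zero fun j => by by_cases hj : j = 2 <;> simp [hj, constantCoeff_X]
    have hP : HasSubst (fun j : Fin 5 => X j.succ + extra j) :=
      hasSubst_of_constantCoeff_zero fun j => by
        simp only [hextra]; by_cases hj : j = 0 <;> simp [hj, constantCoeff_X]
    simp only [← coe_substAlgHom hT, ← coe_substAlgHom hP, map_add, map_mul, map_pow, substAlgHom_X]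
    simp only [hextra, Fin.isValue, Fin.reduceEq, ↓reduceIte, add_zero]
    linear_combination (-(X 0 * X (Fin.succ (0 : Fin 5)) * X (Fin.succ (1 : Fin 5)) : MvPowerSeries (Fin (5 + 1)) k)) * h2

/-- R4-4, idle directions: the F11 node germ does not involve `y, s₁` (variables `3, 4`), so it is honestly
trivial along them. [OURS · L1 W4.3] -/
theorem f11_twistedTrivialFix_idle (p : ℕ) (i : Fin 5) (hi : i = 3 ∨ i = 4) :
    TwistedTrivialAlongFix p (X 0 ^ 2 + X 2 * X 1 ^ 2 : MvPowerSeries (Fin 5) k) (axisCurve i) := by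
  classical
  apply twistedTrivialAlongFix_axis_of_idle
  apply idle_of_subst_kill_eq
  have hK := hasSubst_keep (k := k) (fun v : Fin 5 => v ≠ i)
  rw [subst_add hK, subst_mul hK, subst_pow hK, subst_pow hK, subst_X hK, subst_X hK, subst_X hK]
  rcases hi with rfl | rfl <;> simp

/-- R4-3 — S1's WILD POINT `h = X² + uZ⁴ + u³S⁴` (char 2; `0 = X, 1 = Z, 2 = S, 3 = u`) is twisted-trivial of
exponent `2¹` along the `u`-axis: at `u = u + σ²`, `h = h(Φ)` with the ORIGIN-FIXING unipotent
`Φ : X ↦ X + σZ² + σ³S² + σuS², Z ↦ Z + σS, S ↦ S, u ↦ u` (the sketch's check: `W = Z² + (σ²+u)S² = (Z+σS)² + uS²`,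
`(σ²+u)(Z⁴ + (σ²+u)²S⁴) = (σ²+u)W²`, `σ²W² + X² = (X + σW)²`). [OURS · L1 W4.3, Sketch-L1-idea-1 v4 §9 R4-3
for the repaired predicate] -/
theorem s1w_twistedTrivialFix_u [CharP k 2] :
    TwistedTrivialAlongFix 2 (X 0 ^ 2 + X 3 * X 1 ^ 4 + X 3 ^ 3 * X 2 ^ 4 : MvPowerSeries (Fin 4) k) (axisCurve 3) := by
  classical
  haveI : CharP (MvPowerSeries (Fin (4 + 1)) k) 2 := charP_of_injective_ringHom C_injective 2
  have h2 : (2 : MvPowerSeries (Fin (4 + 1)) k) = 0 := CharP.ofNat_eq_zero _ 2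
  -- shifted variables: `σ = X 0, X = X 1, Z = X 2, S = X 3, u = X 4`
  set extra : Fin 4 → MvPowerSeries (Fin (4 + 1)) k := fun j =>
    if j = 0 then X 0 * X (Fin.succ (1 : Fin 4)) ^ 2 + X 0 ^ 3 * X (Fin.succ (2 : Fin 4)) ^ 2
      + (X 0 * X (Fin.succ (3 : Fin 4))) * X (Fin.succ (2 : Fin 4)) ^ 2
    else if j = 1 then X 0 * X (Fin.succ (2 : Fin 4)) else 0 with hextra
  have hK := hasSubst_keep (k := k) (fun v : Fin (4 + 1) => v = 0)
  refine twistedTrivialAlongFix_of_unipotent 2 1 (by norm_num) _ 3 extra (fun j => ?_) (fun j l => ?_) (fun j => ?_) ?_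
  · simp only [hextra]; split_ifs <;> simp [constantCoeff_X]
  · simp only [hextra]
    split_ifs
    · rw [map_add, map_add, coeff_single_one_mul_eq_zero _ _ (by simp [constantCoeff_X]) (by simp [constantCoeff_X]),
        coeff_single_one_mul_eq_zero _ _ (by simp [constantCoeff_X]) (by simp [constantCoeff_X]),
        coeff_single_one_mul_eq_zero _ _ (by simp [constantCoeff_X]) (by simp [constantCoeff_X]), add_zero, add_zero]
    · exact coeff_single_one_mul_eq_zero _ _ (by simp [constantCoeff_X]) (by simp [constantCoeff_X]) _
    · simp
  · have hKeq : (fun v : Fin (4 + 1) => if v = 0 then (X (0 : Fin (4 + 1)) : MvPowerSeries (Fin (4 + 1)) k) else 0) =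
        fun v : Fin (4 + 1) => if v = 0 then (X v : MvPowerSeries (Fin (4 + 1)) k) else 0 := by
      funext v; by_cases hv : v = 0 <;> simp [hv]
    rw [hKeq]
    simp only [hextra]
    split_ifs
    · simp only [subst_add hK, subst_mul hK, subst_pow hK, subst_X hK]
      simp
    · rw [subst_mul hK, subst_X hK, subst_X hK]
      simp
    · rw [← coe_substAlgHom hK, map_zero]
  · have hT : HasSubst (fun j : Fin 4 => X j.succ +
        if j = 3 then (X (0 : Fin (4 + 1)) : MvPowerSeries (Fin (4 + 1)) k) ^ (2 ^ 1) else 0) :=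
      hasSubst_of_constantCoeff_zero fun j => by by_cases hj : j = 3 <;> simp [hj, constantCoeff_X]
    have hP : HasSubst (fun j : Fin 4 => X j.succ + extra j) :=
      hasSubst_of_constantCoeff_zero fun j => by
        simp only [hextra]; by_cases hj : j = 0 <;> by_cases hj' : j = 1 <;> simp [hj, hj', constantCoeff_X]
    simp only [← coe_substAlgHom hT, ← coe_substAlgHom hP, map_add, map_mul, map_pow, substAlgHom_X]
    simp only [hextra, Fin.isValue, Fin.reduceEq, ↓reduceIte, add_zero]
    -- shifted names: `σ = X 0`, `X = x0`, `Z = x1`, `S = x2`, `u = x3`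
    set x0 : MvPowerSeries (Fin (4 + 1)) k := X (Fin.succ (0 : Fin 4))
    set x1 : MvPowerSeries (Fin (4 + 1)) k := X (Fin.succ (1 : Fin 4))
    set x2 : MvPowerSeries (Fin (4 + 1)) k := X (Fin.succ (2 : Fin 4))
    set x3 : MvPowerSeries (Fin (4 + 1)) k := X (Fin.succ (3 : Fin 4))
    linear_combination ((-2) * X 0 * x1 ^ 3 * x2 * x3 - X 0 * x0 * x2 ^ 2 * x3 - X 0 * x0 * x1 ^ 2
      + X 0 ^ 2 * x2 ^ 4 * x3 ^ 2 - 4 * X 0 ^ 2 * x1 ^ 2 * x2 ^ 2 * x3 - 2 * X 0 ^ 3 * x1 * x2 ^ 3 * x3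
      - X 0 ^ 3 * x0 * x2 ^ 2 - X 0 ^ 4 * x1 ^ 2 * x2 ^ 2 : MvPowerSeries (Fin (4 + 1)) k) * h2

end GradedGame

end Summit.ResolutionOfSingularities.ResolutionOfSingularities.Theorems
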